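import Summits.HodgeConjecture.HodgeConjecture.Theses.NikulinTwinTransport
import Summits.HodgeConjecture.HodgeConjecture.Theorems.NikulinSerreCarrier.Negative.InvariantCarrierPinned
import Literature.AlgebraicGeometry.HodgeTheory.ChernCharacterBetti
import Literature.AlgebraicGeometry.HodgeTheory.HardLefschetzComplexification
import Literature.AlgebraicGeometry.Surfaces.K3NikulinInvolution

/-!
# Line `neron-severi-intertwiner` — skeleton for the crux `NikulinTwinTransport.NikulinSerreCarrier`
(crux item stmt-HodgeConjecture-14464, rank 3, route `route-HodgeConjecture-NikulinTwinTransport`;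
crux-plan seat planner-cruxplan-stmt-HodgeConjecture-14464-neron-severi-intertw-0, 2026-08-16)

## STATUS OF THE CRUX DECL — read first
The route item is INFORMAL: `signature: null`; `Theses/NikulinTwinTransport.lean` (rev 6) has NO
`def NikulinSerreCarrier` (only the `--` comment block). The route name
`…Theses.NikulinTwinTransport.NikulinSerreCarrier` does not exist, so nothing can conclude it by name, and
`workitem set-signature` cannot fix that from a crux seat (no imports; the needed notions are outside the route
file's import closure — probe `scratch/ImportProbe.lean`). Following the convention both crux-plan seats of this
crux adopted today, the typed statement lives in the crux directory and the line is audited against it: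
THIS SKELETON CONCLUDES, BY NAME, the typed ALGEBRAIC NORMAL FORM `NikulinSerreCarrierAlg` — declared below in the
line's namespace as a VERBATIM COPY of `Summit.HodgeConjecture.HodgeConjecture.Cruxes.NikulinSerreCarrier.NikulinSerreCarrierAlg`
(crux work-file `TypedCruxAlg.lean`, lean rc 0, 0 sorry — the copy proposed to the route planner as the item's
signature: evidence SIGNATURE-PROPOSAL.md; definition items `defn-IsKaehlerClass`, `defn-IsMuStableBetti`). The copy
is forced: crux work-files are NOT built as importable modules on the farm (`remote:stale:unbuilt` for `TypedCruxAlg`,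
`TypedCrux`, `Disproof`), so a Lines file cannot import them. Audit:
`ledger skeleton check <this file> --crux stmt-HodgeConjecture-14464 --crux-decl Summit.HodgeConjecture.HodgeConjecture.Cruxes.NikulinSerreCarrier.NeronSeveriIntertwiner.NikulinSerreCarrierAlg`.
The day the route adopts the body, `theorem NikulinSerreCarrier_of : NikulinSerreCarrier := NikulinSerreCarrierAlg_of`
retargets it. Four registered stubs `stub_*` (sorry only there) and the kernel-checked composition
`NikulinSerreCarrierAlg_of` (no sorry of its own).

## The crux (informal, abridged) and the idea
K1: at the Nikulin anchor `(X, ι)`, `Y′ = res(X/ι)`, `Ψ = g^* ⊕ (N_j ↦ r_j)` (rational Hodge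
2-similitude `H²(Y′) → H²(X)`, algebraic graph at the anchor), for the Ψ-matched frame `ω = Ψ(ω′)` there is
an `ω ⊞ ω′`-POLYSTABLE reflexive `G` on `X × Y′` with `c₁(G)` invariant and `c₂(G)^{(2,2)} = m·graph Ψ`,
`m ≠ 0`. Idea `neron-severi-intertwiner` (ideator 2; triage r1-1/2/3: pass, pass, pass): for ANY coherent
`G` on the projective fourfold `W = X × Y′` the mixed class `κ_G := c₂(End G)^{mix} = (c₁²)^{mix} − 2r·ch₂^{mix}`
read as a correspondence `H²(Y′) → H²(X)` is a Hodge morphism, hence `c_T·Ψ` on `T(Y′)` AUTOMATICALLY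
(very general anchor: `Hom_Hdg(T(Y′), H²(X)/NS) = ℚ·Ψ_T`), and `SU(2)`-compatibility in a Ψ-matched frame is
a finite set of LINEAR conditions on the Néron–Severi block; so K1 is equivalent to a purely ALGEBRAIC
statement — `μ_Ω`-STABILITY of a vector bundle for ONE rational Ψ-matched ample class `Ω = Ψ(H′) ⊞ H′`
plus the EXACT class identity `[κ_G]_* = m·Ψ` — whose transcendental part is free. Triage sharpenings
adopted: (r1-2) the "controlled junk for rational directions" clause is DROPPED (it contradicts the landed
`Theorems/TwinTwistorTransport/Negative/GenericFirstLine.lean`): exact identity; (r1-1/r1-3) the carrier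
must be E₈(−2)-COUPLED, `P₋(κ) ≠ 0` — automatic here since `κ = m·Ψ` and `Ψ(N_j) = r_j ∈ E₈(−2)`
(`InvariantCarrierPinned` / Lemma L kill only carriers with `im κ ⊆ E₈(−2)^⊥`); (r1-3) "exactly `m·graphΨ`"
needs the Hodge-rigidity argument, made a stub hypothesis (`AnchorFrame.rigid`) and a stub
(`stub_blockCriterion`) rather than a genericity hand-wave.

## THE LINE (4 registered stubs, glued by `NikulinSerreCarrierAlg_of`)
* `stub_nikulinAnchorFrame` (S1, M/L) — a RIGID NIKULIN ANCHOR WITH A RATIONAL MATCHED KÄHLER FRAME EXISTS: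
  projective K3s `X, Y`, a Nikulin involution `ι` on `X`, integral generators of `H⁴`, a rational
  type-preserving 2-similitude `Ψ : H²(Y) → H²(X)` whose `ι`-anti-invariant classes come from divisors of
  `Y` (`Ψ(N_j) = r_j`), with ALGEBRAIC graph (Varesco 2023 §2 + divisor products), Hodge-RIGID
  (`Hom_Hdg(T(Y), H²(X)/NS(X)) = ℚ·Ψ`: very general member, `End_Hdg T(X) = ℚ`), and a rational class `H′`
  with `H′`, `Ψ H′` and `Ω = Ψ H′ ⊞ H′` KÄHLER (= ℚ-ample; `ω′ = h − Σ ε_j N_j`, Disproof §I, even `d`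
  per `AnchorConeCondition`), plus a positively oriented volume generator of `W`. Known mathematics;
  formal debt: `Y′`, `Bl₈X`, Fubini–Study Kähler metrics on Hodge models.
* `stub_kappaActionHodge` (S2, M) — for a vector bundle `G` on `X ⊗ Y` the action `[κ_G]_*` is, up to the
  orientation scalar, RATIONAL, and it PRESERVES HODGE TYPES (ch algebraic for bundles + products of
  algebraic classes algebraic + algebraic correspondences act by Hodge morphisms + Gysin rationality: tree
  `ChernCharacterBetti.ch_mem_algebraicClasses`, `AlgebraicClassesCup`, `CorrespondenceActionHodgeClasses`,
  `ComplexGysinRational`, `ComplexGysinOrientation`).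
* `stub_stableCarrierNSBlock` (S3, XL — THE HEART) — at every anchor frame of S1, for every Chern character
  that is coherent-additive and sign-normalised: a `μ_Ω`-STABLE VECTOR BUNDLE `G` of rank `r ≥ 3` on
  `X ⊗ Y` whose intertwiner acts as `m·Ψ` ON THE NÉRON–SEVERI BLOCK and as `m·Ψ` MODULO `NS(X)` on
  `T(Y) = NS(Y)^⊥` (`m ≠ 0`). Rank `≥ 3` by the card's defect law (`λ = 2t′/t′²` integral iff
  `t′ = ±N_j`: no rank-2 Serre-from-`Γ` carrier, incl. twisted determinants; = gen-1 E1/E2, Disproof §J);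
  design constraints from Disproof gen 2: §F (every carrier has `E₈`-twisted Harder–Narasimhan pieces
  `𝒪(−(m/2d)r_j) ⊠ 𝒪(d)` along each `X × N_j`), §K (quotient family non-constant along `N_j`, charge bound
  near the orbifold wall), §E (slice vectors `v² ≥ 8`), §A/§C (true `m` even and `> 0`).
* `stub_blockCriterion` (S4, M) — HODGE BLOCK CRITERION: for projective K3s and a rational type-preserving
  2-similitude `Ψ`, a type-preserving `κ` which is rational up to a scalar, equal to `m·Ψ` on `NS(Y)` and
  to `m·Ψ mod NS(X)` on `NS(Y)^⊥`, IS `m·Ψ` (irreducibility of `T(Y)_ℚ`, Huybrechts Ch. 3 Lemma 3.1;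
  `H² = NS ⊕ T`; `Hom_Hdg(T, NS) = 0`).
* `NikulinSerreCarrierAlg_of : NikulinSerreCarrierAlg` — S1 gives the anchor, S3 the bundle, S2 + S4 upgrade the
  block identity to the exact identity `[κ_G]_* = m·Ψ`.

## Disproof.lean honoured (crux dir, gen 2, 2026-08-16) / landed Negative lemmas
No `_false_without_` theorem exists (informal crux). §A (`m_even_of_halfIntegral`) and §C (sign law):
`NikulinSerreCarrierAlg` quantifies `m ∈ ℂ ∖ 0` — the orientation family `μ` and the Chern-character instance `C` are only
pinned up to non-zero scalars on this carrier, so integrality/evenness/positivity of the TRUE `m` are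
theorems about the true instance, not statement content; no stub asserts `m` odd, negative or integral-free.
§D (generic frame ⇒ `c₁ = 0`): not contradicted — the frame here is RATIONAL (`c₁(G)` free), the generic
matched directions are reached afterwards by openness of stability (line card, Transfer). §F/§K/§E: design
constraints on S3, recorded in its docstring; no stub fixes rank 2, a Serre-from-`Γ` shape, constant
quotients along `N_j`, or small charge. `Theorems/NikulinSerreCarrier/Negative/InvariantCarrierPinned.lean`
(imported, checked): refutes carriers KILLING `E₈(−2)`; every object here has `[κ]_* = m·Ψ` with `Ψ`
bijective, so `im κ = H²(X) ⊄ E₈(−2)^⊥` — not an instance. `TwinTwistorTransport/Negative/GenericFirstLine`,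
`PolystableCrossTerm`: the junk clause they kill is dropped (exact identity); `AnchorConeCondition`: S1's
frame is the even-degree admissible one.
-/

noncomputable section

open CategoryTheory CategoryTheory.Limits AlgebraicGeometry
open scoped Manifold ContDiff
open Literature.AlgebraicGeometry
open Literature.AlgebraicGeometry.HodgeTheory
open Literature.AlgebraicTopology.SingularHomology
open Literature.Geometry.Kaehler

set_option linter.dupNamespace false
set_option linter.unusedVariables false

namespace Summit.HodgeConjecture.HodgeConjecture.Cruxes.NikulinSerreCarrier.NeronSeveriIntertwiner

/-! ## Vocabulary of the algebraic normal form (all on the real carrier `H^*(–(ℂ); ℂ)`) -/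

/-- Degree bookkeeping: `2·1 + 2·3 = 2·4`. -/
theorem deg_1_3 : 2 * 1 + 2 * 3 = 2 * 4 := by norm_num

/-- Degree bookkeeping: `2·1 + 2·2 = 2·1 + 2·2` (cup `snd^* y ∪ γ` lands in `H⁶`). -/
theorem deg_1_2 : 2 * 1 + 2 * 2 = 2 * 1 + 2 * 2 := rfl

/-- **Kähler class** on the summit carrier: `H ∈ H²(S(ℂ); ℂ)` is the class of the Kähler form of a
smooth Kähler metric `g` on some Hodge model `A` of `S` (its analytification), read through a natural
multiplicative real de Rham comparison family `e` and the comparison `A.pullback` — verbatim the idiom of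
`HodgeModel.existsUnique_pullback_eq_kaehlerClass`. A RATIONAL Kähler class on a projective variety is a
`ℚ`-ample class (Kodaira); this is how "ample" is said below, and it is what the informal K1 → K2 interface
needs (product hyperkähler metrics exist exactly in Kähler classes). -/
def IsKaehlerClass (n : ℕ) (S : Motives.SchemeOver ℂ) (H : complexBetti S 2) : Prop :=
  ∃ (A : HodgeModel n S)
    (hω : isSmoothForm_kaehlerForm_of_isManifold_complex (E := A.model) (M := A.carrier))
    (g : Bundle.ContMDiffRiemannianMetric 𝓘(ℝ, A.model) ∞ A.model
      (fun x : A.carrier ↦ TangentSpace 𝓘(ℝ, A.model) x))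
    (hg : g.toRiemannianMetric.IsKaehler)
    (e : Literature.NumberTheory.Transcendental.DeRhamIsoFamily 𝓘(ℝ, A.model)),
    e.IsNatural ∧ e.IsMultiplicative ∧
      A.pullback 2 H = ofRealClass A.carrier 2 (e A.carrier 2 (g.kaehlerClass hω hg))

/-- **Coherent additivity** of a Chern character `C` on `W`: `ch(F) = ch(F′) + ch(F″)` for every short
exact sequence of finitely presented `𝒪_W`-modules (Fulton §15.1: on a smooth quasi-projective variety `ch`
extends additively from vector bundles to coherent sheaves through finite locally free resolutions).
`ChernCharacterBetti.ch_shortExact` asserts this for bundles only (its intended instance is `0` off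
bundles), so the normal form quantifies over ALL instances `C` and asks this — on smooth projective
varieties, where resolution-extended instances exist — as the hypothesis pinning `ch` on the torsion-free,
non-locally-free subsheaves that slope stability tests. -/
def CoherentAdditive (C : ChernCharacterBetti) (W : Motives.SchemeOver ℂ) : Prop :=
  ∀ (S : ShortComplex W.left.Modules), S.ShortExact →
    SheafOfModules.IsFinitePresentation S.X₁ → SheafOfModules.IsFinitePresentation S.X₂ →
      SheafOfModules.IsFinitePresentation S.X₃ →
        ∀ i : ℕ, C.ch W S.X₂ i = C.ch W S.X₁ i + C.ch W S.X₃ i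

/-- `F` has (generic) rank `s` as read by `C`: `ch₀(F) = s · 1` (for a vector bundle on the connected `W`
its rank, `ChernCharacterBetti.ch_free_zero`; for coherent `F` the alternating sum of the ranks of a
locally free resolution = the generic rank, granted `CoherentAdditive C W`). -/
def HasChRank (C : ChernCharacterBetti) (W : Motives.SchemeOver ℂ) (F : W.left.Modules) (s : ℕ) :
    Prop :=
  C.ch W F 0 = (s : ℂ) • singularCohomology.one ℂ (Motives.ComplexPoints W)

/-- `deg_Ω(F) = d` on a fourfold `W`: `ch₁(F) ∪ Ω³ = d · vol` for the chosen volume generator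
`vol ∈ H⁸(W(ℂ); ℂ)` (Huybrechts–Lehn Def. 1.2.11, `deg_H E = c₁(E)·H^{n−1}`, `c₁ = ch₁`). -/
def HasDegree (C : ChernCharacterBetti) (W : Motives.SchemeOver ℂ) (Ω : complexBetti W (2 * 1))
    (vol : complexBetti W (2 * 4)) (F : W.left.Modules) (d : ℚ) : Prop :=
  cupProduct deg_1_3 (C.ch W F 1) (cupPowTwo Ω 3) = (d : ℂ) • vol

/-- The volume generator is POSITIVELY oriented by the frame: `Ω⁴ = q · vol`, `q > 0` (the sign of every
degree is then that of an intersection number with the positive class `Ω`, independent of orientation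
conventions and of the orientation family `μ`). -/
def PositivelyOriented (W : Motives.SchemeOver ℂ) (Ω : complexBetti W (2 * 1))
    (vol : complexBetti W (2 * 4)) : Prop :=
  ∃ q : ℚ, 0 < q ∧ cupPowTwo Ω 4 = (q : ℂ) • vol

/-- Effective line bundles have non-negative `Ω`-degree: for every `𝒪_W`-module `L` of rank `≤ 1` receiving
a monomorphism from `𝒪_W`, `deg_Ω(L) ≥ 0`. -/
def EffectiveNonneg (C : ChernCharacterBetti) (W : Motives.SchemeOver ℂ) (Ω : complexBetti W (2 * 1))
    (vol : complexBetti W (2 * 4)) : Prop :=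
  ∀ (L : W.left.Modules), Motives.HasRankLE L 1 →
    (∃ s : SheafOfModules.free (R := W.left.ringCatSheaf) PUnit ⟶ L, Mono s) →
      ∃ d : ℚ, 0 ≤ d ∧ HasDegree C W Ω vol L d

/-- **Sign normalisation of the instance `C`** (a property of the Chern character, FALSE for the
sign-flipped instance `((-1)^i chᵢ)`, which satisfies every field of `ChernCharacterBetti`): on every smooth
projective fourfold, for every Kähler class `Ω` and positively oriented volume generator, effective line
bundles have non-negative `Ω`-degree (`∫_D Ω³ ≥ 0`). Quantifying over all `C` with THIS hypothesis makes
"`μ_Ω`-stable" mean stable rather than anti-stable; the remaining ambiguity among instances is a positive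
rational rescaling `chᵢ ↦ λⁱ chᵢ`, under which everything below is invariant. -/
def SignNormalised (C : ChernCharacterBetti) : Prop :=
  ∀ (W : Motives.SchemeOver ℂ) (Ω : complexBetti W (2 * 1)) (vol : complexBetti W (2 * 4)),
    Motives.IsSmoothProjective 4 W → IsKaehlerClass 4 W Ω → PositivelyOriented W Ω vol →
      EffectiveNonneg C W Ω vol

/-- **Slope (Mumford–Takemoto) STABILITY** of an `𝒪_W`-module `G` of rank `r` on the fourfold `W` with
respect to `Ω` (Huybrechts–Lehn Def. 1.2.12, strict form): `deg_Ω G = d_G ∈ ℚ` and every coherent subsheaf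
`F ↪ G` of rank `s`, `0 < s < r`, has `deg_Ω F = d_F` with `d_F · r < d_G · s` (`μ(F) < μ(G)`). Companion of
the tree's `Motives.IsSlopeSemistable` (abstract Weil cohomology, `≤`), here on the real carrier. -/
def IsMuStable (C : ChernCharacterBetti) (W : Motives.SchemeOver ℂ) (Ω : complexBetti W (2 * 1))
    (vol : complexBetti W (2 * 4)) (G : W.left.Modules) (r : ℕ) : Prop :=
  ∃ dG : ℚ, HasDegree C W Ω vol G dG ∧
    ∀ (F : W.left.Modules) (f : F ⟶ G), Mono f → SheafOfModules.IsFinitePresentation F →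
      ∀ s : ℕ, 0 < s → s < r → HasChRank C W F s →
        ∃ dF : ℚ, HasDegree C W Ω vol F dF ∧ dF * r < dG * s

/-- **The Néron–Severi intertwiner class** `κ_G := c₂(End G) = ch₁(G)² − 2r·ch₂(G) ∈ H⁴(W(ℂ); ℂ)` of a
rank-`r` sheaf (`ch(End G) = ch(G)·ch(G^∨)` gives `ch₂(End G) = 2r·ch₂ − ch₁²`, and `c₂ = −ch₂` as
`c₁(End G) = 0`); twist-invariant; its `(2,2)`-Künneth component is the card's `κ`. -/
def kappaClass (C : ChernCharacterBetti) (W : Motives.SchemeOver ℂ) (G : W.left.Modules) (r : ℕ) :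
    complexBetti W (2 * 2) :=
  cupProduct (rfl : 2 * 1 + 2 * 1 = 2 * 2) (C.ch W G 1) (C.ch W G 1) - (2 * (r : ℂ)) • C.ch W G 2

/-- The ACTION `[γ]_* : H²(Y(ℂ)) → H²(X(ℂ))`, `y ↦ fst_*(snd^* y ∪ γ)`, of a class `γ ∈ H⁴((X ⊗ Y)(ℂ))` on a
product of smooth projective surfaces, as a linear map — the shape used verbatim by the route's items
(`TwinSimilitudeAlgebraic`, `HodgeIsometryAlgebraic`). Only the `(2,2)`-Künneth component of `γ` acts. -/
def corrAction (μ : OrientationFamily) {X Y : Motives.SchemeOver ℂ} (hX : Motives.IsSmoothProjective 2 X)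
    (hY : Motives.IsSmoothProjective 2 Y) (γ : complexBetti (MonoidalCategoryStruct.tensorObj X Y) (2 * 2)) :
    complexBetti Y (2 * 1) →ₗ[ℂ] complexBetti X (2 * 1) :=
  complexGysin μ (Motives.IsSmoothProjective.tensor_holds hX hY) hX (SemiCartesianMonoidalCategory.fst X Y)
      (rfl : 2 * 1 + 2 * 2 + 2 * 2 = 2 * 1 + 2 * (2 + 2)) ∘ₗ
    (cupProduct deg_1_2).flip γ ∘ₗ
      (complexBetti.map (SemiCartesianMonoidalCategory.snd X Y) (2 * 1)).hom

/-- Unfolding `corrAction`: `[γ]_* y = fst_*(snd^* y ∪ γ)`. -/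
theorem corrAction_apply (μ : OrientationFamily) {X Y : Motives.SchemeOver ℂ}
    (hX : Motives.IsSmoothProjective 2 X) (hY : Motives.IsSmoothProjective 2 Y)
    (γ : complexBetti (MonoidalCategoryStruct.tensorObj X Y) (2 * 2)) (y : complexBetti Y (2 * 1)) :
    corrAction μ hX hY γ y =
      complexGysin μ (Motives.IsSmoothProjective.tensor_holds hX hY) hX
        (SemiCartesianMonoidalCategory.fst X Y) (rfl : 2 * 1 + 2 * 2 + 2 * 2 = 2 * 1 + 2 * (2 + 2))
        (cupProduct deg_1_2 (complexBetti.map (SemiCartesianMonoidalCategory.snd X Y) (2 * 1) y) γ) :=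
  rfl

/-- `p` generates the integral classes of `H⁴` of a surface (verbatim the route's clause). -/
def IsTopGenerator {S : Motives.SchemeOver ℂ} (p : complexBetti S (2 * 2)) : Prop :=
  IsIntegralClass p ∧ ∀ q : complexBetti S (2 * 2), IsIntegralClass q → ∃ n : ℤ, q = n • p

/-- `Ψ : H²(Y(ℂ)) → H²(X(ℂ))` is a RATIONAL, TYPE-PRESERVING **2-similitude** for the generators `p, p'`:
`(x.y) = a p' ⟹ (Ψx.Ψy) = 2a p` (verbatim the hypothesis block of `TwinSimilitudeAlgebraic`). -/
def IsRationalHodgeTwoSimilitude {X Y : Motives.SchemeOver ℂ} (p : complexBetti X (2 * 2))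
    (p' : complexBetti Y (2 * 2)) (Ψ : complexBetti Y (2 * 1) →ₗ[ℂ] complexBetti X (2 * 1)) : Prop :=
  (∀ x, IsRationalClass x → IsRationalClass (Ψ x)) ∧
  (∀ (i j : ℕ) x, IsOfHodgeType 2 Y (2 * 1) i j x → IsOfHodgeType 2 X (2 * 1) i j (Ψ x)) ∧
  (∀ (x y : complexBetti Y (2 * 1)) (a : ℂ),
    cupProduct (rfl : 2 * 1 + 2 * 1 = 2 * 2) x y = a • p' →
      cupProduct (rfl : 2 * 1 + 2 * 1 = 2 * 2) (Ψ x) (Ψ y) = ((2 : ℂ) * a) • p)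

/-- The Ψ-MATCHED product class `Ω(H′) := fst^*(Ψ H′) + snd^* H′ ∈ H²((X ⊗ Y)(ℂ))`. -/
def matchedClass {X Y : Motives.SchemeOver ℂ} (Ψ : complexBetti Y (2 * 1) →ₗ[ℂ] complexBetti X (2 * 1))
    (H' : complexBetti Y (2 * 1)) : complexBetti (MonoidalCategoryStruct.tensorObj X Y) (2 * 1) :=
  complexBetti.map (SemiCartesianMonoidalCategory.fst X Y) (2 * 1) (Ψ H') +
    complexBetti.map (SemiCartesianMonoidalCategory.snd X Y) (2 * 1) H'

/-- `NS(Y)_ℂ^⊥`-membership: `t` is orthogonal to every class supported on a divisor (`t ∈ T(Y)_ℂ`). -/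
def IsTranscendental {Y : Motives.SchemeOver ℂ} (t : complexBetti Y (2 * 1)) : Prop :=
  ∀ d ∈ algebraicClasses Y 1, cupProduct (rfl : 2 * 1 + 2 * 1 = 2 * 2) t d = 0

/-! ## The typed crux decl this line concludes (verbatim copy of `TypedCruxAlg.lean`) -/

/-- **`NikulinSerreCarrierAlg` — algebraic normal form of the informal crux `NikulinSerreCarrier`
(neron-severi-intertwiner, triage-sharpened; PROPOSED signature).** VERBATIM COPY of
`Summit.HodgeConjecture.HodgeConjecture.Cruxes.NikulinSerreCarrier.NikulinSerreCarrierAlg` (crux work-file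
`TypedCruxAlg.lean`, the copy offered to the route planner): crux work-files are not built as importable modules on
the Lean farm (`lean check` answers `remote:stale:unbuilt` for `…Cruxes.NikulinSerreCarrier.TypedCruxAlg`, `.TypedCrux`
and `.Disproof`), so the decl is restated here, in the line's namespace, and the skeleton is audited against THIS
name; keep the two copies in sync. For every orientation family with Poincaré duality and every Chern character `C` that
is coherent-additive on smooth projective varieties and sign-normalised, there are projective K3 surfaces
`X, Y` (the anchor), integral generators `p, p'` of `H⁴`, a rational type-preserving 2-similitude
`Ψ : H²(Y) → H²(X)`, a RATIONAL class `H′` on `Y` with `H′`, `Ψ H′` and the matched product class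
`Ω = Ψ H′ ⊞ H′` Kähler (the rational Ψ-matched ample frame), a positively oriented volume generator of
`W = X ⊗ Y`, and a VECTOR BUNDLE `G` of rank `r` on `W`, `μ_Ω`-STABLE, whose intertwiner class acts on
`H²(Y)` EXACTLY as a non-zero multiple of `Ψ`: `[κ_G]_* = m·Ψ`, `m ≠ 0` (`m ∈ ℂ`: the TRUE `m` is an even
positive integer, Disproof §A/§C/§H — invisible on this carrier, where `μ` and `C` are pinned only up to
non-zero scalars). Informal K1 follows (line card, Transfer): `End G` is `Ω`-polystable with `c₁ = 0` and
`c₂(End G) = κ_G`; `Ω` is a Ψ-matched Kähler pair; openness of stability reaches the generic matched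
directions. -/
def NikulinSerreCarrierAlg : Prop :=
  ∀ (μ : OrientationFamily), μ.HasPoincareDuality → ∀ (C : ChernCharacterBetti),
    (∀ (n : ℕ) (W : Motives.SchemeOver ℂ), Motives.IsSmoothProjective n W → CoherentAdditive C W) →
    SignNormalised C →
    ∃ (X Y : Motives.SchemeOver ℂ) (hX : Surfaces.IsK3Surface X) (hY : Surfaces.IsK3Surface Y)
      (p : complexBetti X (2 * 2)) (p' : complexBetti Y (2 * 2))
      (Ψ : complexBetti Y (2 * 1) →ₗ[ℂ] complexBetti X (2 * 1)) (H' : complexBetti Y (2 * 1))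
      (vol : complexBetti (MonoidalCategoryStruct.tensorObj X Y) (2 * 4))
      (r : ℕ) (G : (MonoidalCategoryStruct.tensorObj X Y).left.Modules) (m : ℂ),
      IsTopGenerator p ∧ IsTopGenerator p' ∧ IsRationalHodgeTwoSimilitude p p' Ψ ∧
      IsRationalClass H' ∧ IsKaehlerClass 2 Y H' ∧ IsKaehlerClass 2 X (Ψ H') ∧
      IsKaehlerClass 4 (MonoidalCategoryStruct.tensorObj X Y) (matchedClass Ψ H') ∧
      PositivelyOriented (MonoidalCategoryStruct.tensorObj X Y) (matchedClass Ψ H') vol ∧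
      Motives.IsVectorBundle G ∧ HasChRank C _ G r ∧
      IsMuStable C _ (matchedClass Ψ H') vol G r ∧ m ≠ 0 ∧
      ∀ y : complexBetti Y (2 * 1), corrAction μ hX.1 hY.1 (kappaClass C _ G r) y = m • Ψ y




/-! ## The anchor package the stubs are stated over -/

/-- **A rigid Nikulin anchor with a rational Ψ-matched Kähler frame** (the data S1 produces and S3 consumes).
`X, Y` projective K3 surfaces; `ι` a Nikulin involution of `X`; `p, p'` integral generators of `H⁴`;
`Ψ : H²(Y) → H²(X)` a rational type-preserving 2-similitude such that (Nikulin type) every `ι^*`-ANTI-INVARIANT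
class of `X` is `Ψ` of a divisor class of `Y` (`E₈(−2) = Ψ⟨N_j⟩`, `Ψ(N_j) = r_j`), with ALGEBRAIC GRAPH (some
algebraic `γ` on `X ⊗ Y` acts as a non-zero multiple of `Ψ`; Varesco 2023 §2 for `g^* = b_*g̃^*` plus the
divisor products `r_j ⊗ N_j`) and HODGE-RIGID (`Hom_Hdg(T(Y), H²(X)/NS(X)) = ℚ·Ψ_T`: every rational
type-preserving `φ` is `c·Ψ` modulo `NS(X)_ℂ` on `T(Y)_ℂ = NS(Y)_ℂ^⊥`); and a RATIONAL class `H′` with `H′`,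
`Ψ H′`, `Ψ H′ ⊞ H′` Kähler, plus a positively oriented volume generator of `W = X ⊗ Y`. -/
structure AnchorFrame where
  /-- the Nikulin K3 -/
  X : Motives.SchemeOver ℂ
  /-- the partner K3 (intended: `Y′ = res(X/ι)`) -/
  Y : Motives.SchemeOver ℂ
  hX : Surfaces.IsK3Surface X
  hY : Surfaces.IsK3Surface Y
  /-- the Nikulin involution -/
  ι : X ⟶ X
  hι : Surfaces.IsNikulinInvolution X ι
  p : complexBetti X (2 * 2)
  p' : complexBetti Y (2 * 2)
  hp : IsTopGenerator p
  hp' : IsTopGenerator p'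
  /-- the completed Nikulin 2-similitude -/
  Ψ : complexBetti Y (2 * 1) →ₗ[ℂ] complexBetti X (2 * 1)
  hΨ : IsRationalHodgeTwoSimilitude p p' Ψ
  /-- Nikulin type: the `ι^*`-anti-invariant classes (`E₈(−2) ⊗ ℂ`) are `Ψ` of divisor classes of `Y`. -/
  antiInvariant_from_divisors : ∀ x : complexBetti X (2 * 1),
    complexBetti.map ι (2 * 1) x = -x → ∃ d ∈ algebraicClasses Y 1, Ψ d = x
  /-- the graph of `Ψ` is algebraic at the anchor (up to the orientation scalar). -/
  graphAlg : ∀ (μ : OrientationFamily), μ.HasPoincareDuality →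
    ∃ γ ∈ algebraicClasses (MonoidalCategoryStruct.tensorObj X Y) 2, ∃ c : ℂ, c ≠ 0 ∧
      ∀ y, corrAction μ hX.1 hY.1 γ y = c • Ψ y
  /-- Hodge rigidity of the anchor (very general member: `End_Hdg T(X)_ℚ = ℚ`). -/
  rigid : ∀ φ : complexBetti Y (2 * 1) →ₗ[ℂ] complexBetti X (2 * 1),
    (∀ x, IsRationalClass x → IsRationalClass (φ x)) →
    (∀ (i j : ℕ) x, IsOfHodgeType 2 Y (2 * 1) i j x → IsOfHodgeType 2 X (2 * 1) i j (φ x)) →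
      ∃ c : ℚ, ∀ t, IsTranscendental t → φ t - (c : ℂ) • Ψ t ∈ algebraicClasses X 1
  /-- the `Y`-side frame class (intended: `h − Σ ε_j N_j`, `ε_j ∈ ℚ_{>0}` small) -/
  H' : complexBetti Y (2 * 1)
  hH'rat : IsRationalClass H'
  kY : IsKaehlerClass 2 Y H'
  kX : IsKaehlerClass 2 X (Ψ H')
  kW : IsKaehlerClass 4 (MonoidalCategoryStruct.tensorObj X Y) (matchedClass Ψ H')
  /-- positively oriented volume generator of `H⁸((X ⊗ Y)(ℂ))` -/
  vol : complexBetti (MonoidalCategoryStruct.tensorObj X Y) (2 * 4)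
  oriented : PositivelyOriented (MonoidalCategoryStruct.tensorObj X Y) (matchedClass Ψ H') vol

/-- The product fourfold of an anchor. -/
abbrev AnchorFrame.W (A : AnchorFrame) : Motives.SchemeOver ℂ := MonoidalCategoryStruct.tensorObj A.X A.Y

/-- The matched frame class `Ω = Ψ H′ ⊞ H′` of an anchor. -/
abbrev AnchorFrame.Ω (A : AnchorFrame) : complexBetti A.W (2 * 1) := matchedClass A.Ψ A.H'

/-! ## S1 — a rigid Nikulin anchor with a rational matched Kähler frame exists -/

/-- **S1 `stub_nikulinAnchorFrame`.** There is a rigid Nikulin anchor with a rational Ψ-matched Kähler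
frame (`AnchorFrame`). Why true: take `X` very general in the van Geemen–Sarti family `NS(X) = ℤL ⊕ E₈(−2)`,
`L² = 2d` with `d` even (no `(−2)`-obstruction in the matched cone: `AnchorConeCondition`), `ι` its Nikulin
involution (`Nikulin_involution_marking`), `Y = Y′` the minimal resolution of `X/ι` (a projective K3, VGS
§1.4–2), `Ψ = b_*g̃^* ⊕ (N_j ↦ r_j)` with the `A₁⁸` frame `r_j` of `E₈(−2)` (`EEightTwoSimilitude`, PROVED):
a rational type-preserving 2-similitude (K1-integrality note: `2Ψ` integral), anti-invariants
`= span r_j = Ψ(span N_j)`; graph algebraic: `[Γ]` (`Γ = Bl₈X`) acts as `g^*` and kills `N_j`, and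
`2·graphΨ = 2[Γ]^{mix} − Σ r_j ⊗ N_j` (Varesco 2023 §2: `β_*π^*` algebraic); rigidity: `End_Hdg(T(X)_ℚ) = ℚ`
for very general `X` (rank `T = 13` odd ⇒ no CM; totally real fields of odd degree excluded generically),
so `Hom_Hdg(T(Y),T(X)) = ℚ·Ψ_T` and `Hom_Hdg(T, NS) = 0`; frame: `H′ = h − Σ ε_j N_j`, `ε_j ∈ ℚ_{>0}`
small, is ample on `Y′` (roots of the Nikulin lattice are `±N_j`, Disproof §I), `Ψ H′ = L_h − Σ ε_j r_j` is
ample on `X` (even `d`), products of ample classes are Kähler (restricted Fubini–Study metrics on the Hodge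
models: `exists_isKaehler_kaehlerForm_eq_fubiniStudyPullbackForm`), and `vol := Ω⁴/q`. Size: M as
mathematics (all printed), L as formalisation (no quotient `X/ι`, blow-up or even-eight API in the tree). -/
theorem stub_nikulinAnchorFrame : Nonempty AnchorFrame := by
  sorry

/-! ## S2 — the intertwiner of a vector bundle acts by a Hodge morphism -/

/-- **S2 `stub_kappaActionHodge`.** For projective K3 surfaces `X, Y` and a VECTOR BUNDLE `G` of rank `r` on
`X ⊗ Y`, the action `[κ_G]_* : H²(Y) → H²(X)` of `κ_G = ch₁(G)² − 2r·ch₂(G)` (i) is RATIONAL up to the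
orientation scalar (`∃ c ≠ 0`, `c·[κ_G]_*` maps rational classes to rational classes) and (ii) PRESERVES
HODGE TYPES. Why true: `chᵢ(G)` are rational algebraic classes (`ChernCharacterBetti.isRationalClass_ch`,
`ch_mem_algebraicClasses`), cup products of algebraic classes are algebraic (Voisin II Prop. 9.20; tree
`HodgeTheory.AlgebraicClassesCup` / `cupProduct_mem_algebraicClasses_of_moving`), an algebraic class acts by a
morphism of Hodge structures (tree `CorrespondenceActionHodgeClasses(OfGysin)`: pull-back, cup with a Hodge
class and Gysin preserve types), and Gysin morphisms are rational for the complex orientation and rescale by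
a non-zero constant for any other orientation family (`ComplexGysinRational`, `ComplexGysinOrientation`).
Size: M (assembly of tree facts; the moving-lemma input rides as their hypothesis). -/
theorem stub_kappaActionHodge :
    ∀ (μ : OrientationFamily), μ.HasPoincareDuality → ∀ (C : ChernCharacterBetti)
      (X Y : Motives.SchemeOver ℂ) (hX : Surfaces.IsK3Surface X) (hY : Surfaces.IsK3Surface Y)
      (G : (MonoidalCategoryStruct.tensorObj X Y).left.Modules) (r : ℕ),
      Motives.IsVectorBundle G →
      (∃ c : ℂ, c ≠ 0 ∧ ∀ y, IsRationalClass y →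
        IsRationalClass (c • corrAction μ hX.1 hY.1 (kappaClass C _ G r) y)) ∧
      (∀ (i j : ℕ) y, IsOfHodgeType 2 Y (2 * 1) i j y →
        IsOfHodgeType 2 X (2 * 1) i j (corrAction μ hX.1 hY.1 (kappaClass C _ G r) y)) := by
  sorry

/-! ## S3 — THE HEART: a stable bundle whose intertwiner has the right Néron–Severi block -/

/-- **S3 `stub_stableCarrierNSBlock` (hardest).** At every rigid Nikulin anchor frame `A` and for every Chern
character `C` that is coherent-additive on smooth projective varieties and sign-normalised, there is a
VECTOR BUNDLE `G` of rank `r ≥ 3` on `W = X ⊗ Y`, `μ_Ω`-STABLE for the matched class `Ω = Ψ H′ ⊞ H′`, and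
`m ≠ 0`, such that `[κ_G]_* d = m·Ψ d` for every divisor class `d` of `Y` (the NÉRON–SEVERI BLOCK: `9 × 9`
linear conditions, among them the `E₈(−2)`-coupling `N_j ↦ m·r_j`) and `[κ_G]_* t − m·Ψ t ∈ NS(X)_ℂ` for every
transcendental `t` (the `T`-part: by `A.rigid` and S2 it is `c_T·Ψ_T` automatically, so this asks only the
scalar condition `c_T = m`, i.e. `κ_G` sees `T(Y)` with the same weight as the divisor block). Why it might be
true / the design (card + Disproof gen 2): NOT a rank-2 Serre bundle of `Γ` (card's defect law
`λ = 2t′/t′²`; gen-1 E1/E2; Disproof §J), so `r ≥ 3` or a non-Serre construction with a rank-eight `X`-side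
correction; along each `X × N_j` the bundle must restrict with `E₈`-twisted Harder–Narasimhan pieces
`𝒪(−(m/2d)·r_j) ⊠ 𝒪(d)` (Disproof §F, necessary) whose quotient family MOVES along `N_j` (§K), slices of Mukai
square `≥ 8` (§E); candidate sources: wall-crossing of a McKay-type object from the orbifold frame `ε = 0`
acquiring the eight elementary pieces simultaneously (Disproof "prover line"), monads / Lazarsfeld–Mukai-type
kernels on `W` twisted by `𝒪(r_j ⊠ N_j)`, or `(1 × f)^*𝓔` for a non-`ι`-fixed modular surface (sister line
modular-twin-address). Stability only for the ONE rational class `Ω` (algebraic Mumford–Takemoto theory: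
restriction theorems, Bogomolov, openness) — no hyperkähler metric, twistor line or analytic Chern class is
needed. Size: XL (open; no construction on record survives the disprover). -/
theorem stub_stableCarrierNSBlock :
    ∀ (μ : OrientationFamily), μ.HasPoincareDuality → ∀ (C : ChernCharacterBetti) (A : AnchorFrame),
      (∀ (n : ℕ) (W : Motives.SchemeOver ℂ), Motives.IsSmoothProjective n W → CoherentAdditive C W) →
      SignNormalised C →
      ∃ (r : ℕ) (G : A.W.left.Modules) (m : ℂ),
        3 ≤ r ∧ Motives.IsVectorBundle G ∧ HasChRank C A.W G r ∧
        IsMuStable C A.W A.Ω A.vol G r ∧ m ≠ 0 ∧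
        (∀ d ∈ algebraicClasses A.Y 1, corrAction μ A.hX.1 A.hY.1 (kappaClass C A.W G r) d = m • A.Ψ d) ∧
        (∀ t, IsTranscendental t →
          corrAction μ A.hX.1 A.hY.1 (kappaClass C A.W G r) t - m • A.Ψ t ∈ algebraicClasses A.X 1) := by
  sorry

/-! ## S4 — Hodge block criterion: NS-block + T-part mod NS ⇒ exact identity -/

/-- **S4 `stub_blockCriterion`.** Let `X, Y` be projective K3 surfaces, `Ψ : H²(Y) → H²(X)` a rational
type-preserving 2-similitude (for integral generators `p, p'`), `κ : H²(Y) → H²(X)` TYPE-PRESERVING and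
RATIONAL UP TO A SCALAR, `m ≠ 0`. If `κ = m·Ψ` on the divisor classes of `Y` and `κ t − m·Ψ t ∈ NS(X)_ℂ` for
all transcendental `t`, then `κ = m·Ψ`. Why true: `λ := κ − m·Ψ` kills `NS(Y)_ℂ` and maps
`T(Y)_ℂ = NS(Y)_ℂ^⊥` into `NS(X)_ℂ ⊂ H^{1,1}`; `λ` preserves types, so `λ(σ_Y) ∈ NS(X)_ℂ ∩ H^{2,0} = 0`;
`m·c ∈ ℚ` for the rationality scalar `c` of `κ` (compare `c·κ d = c·m·Ψ d` on a rational divisor class `d`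
with `Ψ d ≠ 0` — `Y` is projective, `(Ψ d)² = 2d² ≠ 0` for an ample `d`), so `c·λ` is defined over `ℚ` and
`ker(c·λ) ∩ H²(Y,ℚ)` is a rational sub-Hodge structure containing `NS(Y)` and `σ_Y`, hence everything by
the IRREDUCIBILITY of `T(Y)_ℚ` (Huybrechts, K3 book, Ch. 3 Lemma 3.1; `H² = NS ⊕ T`, Hodge index). Size: M
(irreducibility of the transcendental lattice and the `NS ⊕ T` splitting on the summit carrier are not yet
tree lemmas; Hodge-model independence of `IsOfHodgeType` is). -/
theorem stub_blockCriterion :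
    ∀ (X Y : Motives.SchemeOver ℂ) (hX : Surfaces.IsK3Surface X) (hY : Surfaces.IsK3Surface Y)
      (p : complexBetti X (2 * 2)) (p' : complexBetti Y (2 * 2))
      (Ψ : complexBetti Y (2 * 1) →ₗ[ℂ] complexBetti X (2 * 1)),
      IsTopGenerator p → IsTopGenerator p' → IsRationalHodgeTwoSimilitude p p' Ψ →
      ∀ (κ : complexBetti Y (2 * 1) →ₗ[ℂ] complexBetti X (2 * 1)) (m : ℂ), m ≠ 0 →
        (∃ c : ℂ, c ≠ 0 ∧ ∀ y, IsRationalClass y → IsRationalClass (c • κ y)) →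
        (∀ (i j : ℕ) y, IsOfHodgeType 2 Y (2 * 1) i j y → IsOfHodgeType 2 X (2 * 1) i j (κ y)) →
        (∀ d ∈ algebraicClasses Y 1, κ d = m • Ψ d) →
        (∀ t, IsTranscendental t → κ t - m • Ψ t ∈ algebraicClasses X 1) →
          ∀ y, κ y = m • Ψ y := by
  sorry

/-! ## Composition — kernel-checked, no `sorry` of its own -/

/-- **`NikulinSerreCarrierAlg_of`** — the line closes the typed crux `NikulinSerreCarrierAlg` BY NAME: S1 supplies the rigid Nikulin anchor with its
rational matched Kähler frame, S3 the `μ_Ω`-stable bundle with the right Néron–Severi block and `T`-scalar,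
S2 the Hodge-morphism property of its intertwiner, and S4 upgrades the block identity to the exact identity
`[κ_G]_* = m·Ψ`. When the route adopts the body as `NikulinSerreCarrier`, add the one-line retarget
`theorem NikulinSerreCarrier_of : NikulinSerreCarrier := NikulinSerreCarrierAlg_of`. -/
theorem NikulinSerreCarrierAlg_of : NikulinSerreCarrierAlg := by
  intro μ hμ C hCadd hCsign
  obtain ⟨A⟩ := stub_nikulinAnchorFrame
  obtain ⟨r, G, m, hr3, hVB, hrk, hst, hm, hNS, hT⟩ :=
    stub_stableCarrierNSBlock μ hμ C A hCadd hCsign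
  obtain ⟨hrat, htype⟩ := stub_kappaActionHodge μ hμ C A.X A.Y A.hX A.hY G r hVB
  have key : ∀ y, corrAction μ A.hX.1 A.hY.1 (kappaClass C A.W G r) y = m • A.Ψ y :=
    stub_blockCriterion A.X A.Y A.hX A.hY A.p A.p' A.Ψ A.hp A.hp' A.hΨ
      (corrAction μ A.hX.1 A.hY.1 (kappaClass C A.W G r)) m hm hrat htype hNS hT
  exact ⟨A.X, A.Y, A.hX, A.hY, A.p, A.p', A.Ψ, A.H', A.vol, r, G, m, A.hp, A.hp', A.hΨ, A.hH'rat,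
    A.kY, A.kX, A.kW, A.oriented, hVB, hrk, hst, hm, key⟩

end Summit.HodgeConjecture.HodgeConjecture.Cruxes.NikulinSerreCarrier.NeronSeveriIntertwiner

end
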